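import Summits.HodgeConjecture.HodgeConjecture.Theorems.Ring2AbelianAllAndreStandardANumerical
import Summits.HodgeConjecture.HodgeConjecture.Theorems.Ring2AbelianAllAndreNumericalCorner
import Summits.HodgeConjecture.HodgeConjecture.Theorems.Ring2AbelianAllAndreLiftOnPath
import Literature.AlgebraicGeometry.HodgeTheory.StandardConjectureAOfHodgeClasses
import HarnessLib

/-!
# Ring 2 · sub-cell AbelianAll (ALL ABELIAN VARIETIES), André axis, part XVIII-i — THE UNCONDITIONAL CODIMENSIONS OF
# "HOM ≡ NUM" ON THE CARRIERS (Matsusaka / Lieberman 1968: codimension `≤ 2` and `≥ n-1`), hence: (Num_t) and (Perf_t)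
# for `q ∈ {0, 1, d-1, d}`, the LIFT (L)_t in degrees `2p` with `p ∈ {0, 1, d-1, d}` for EVERY compact pencil of abelian
# varieties, and **the lift (L∀) for all compact pencils of relative dimension `d ≤ 3` — UNCONDITIONALLY** (part VI had
# `d ≤ 2`; the first open case of the lift moves to `d = 4`, `p = 2`)

HONEST FRAMING (page 1, verbatim): **research route, not a corollary; conditional on HC_CM plus one named
minimal statement.** Cell line: research route conditional on HC_CM; not a corollary; Q11.4-sentence-2
already refuted in dim ≥ 3. Nothing in this file proves a case of the Hodge conjecture for an abelian variety;
`HC_CM` does not occur in this file. Seat `pub-hodge-ring2-ab-andre-2`, gen 10 (sequel of parts XVIII-a/b/d/g).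

## The argument

Part XVIII-d proves, for the class `κ` of a Kähler–rational datum: [surjectivity of `L^{n-2p'} : N^{p'} → N^{n-p'}` for all
`p' < p` with `p' + p ≤ n`] ⟹ [the Lefschetz components of every `x ∈ N^p` are algebraic] ⟹ [`ξ ∈ N^p` cup-orthogonal to
`N^{n-p}` vanishes]. The surjectivity clause holds UNCONDITIONALLY for `p' ≤ 1` (Lefschetz `(1,1)` + hard Lefschetz over `ℚ`,
the tree's `lefschetzPow_surjOn_algebraicClasses_of_hodgeClasses_algebraic`), and `p' ≤ 1` is all that is asked when `p ≤ 2`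
or `p ≥ n - 1`. Hence (§1) homological ≡ numerical equivalence for algebraic classes of codimension `≤ 2` or `≥ n - 1` on
every smooth projective complex variety — Matsusaka (divisors), Lieberman 1968 (codimension 2, dimension 1) — on the
carriers. For a compact pencil `f : 𝒳 ⟶ S` of abelian `d`-folds (§2): (Num_t)(p,q) is the codimension-`(q+1)` statement on
the `(d+1)`-fold `𝒳`, unconditional for `q ≤ 1` or `q ≥ d - 1`; (Perf_t)(p,q) is unconditional for the same `q`; so by part
XVIII-a the lift (L)_t holds in degree `2p` for `p ∈ {0, 1, d-1, d}` — in EVERY degree when `d ≤ 3`.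

## What is proved (theorems only; no definition, no named fact, no sorry)

§1 `surjOn_lefschetzPow_algebraicClasses_of_le_one`; **`eq_zero_of_forall_cupProduct_algebraic_eq_zero_of_extreme` (+ `'`),
`nondegenerate_algebraicClasses_of_extreme`** (hom ≡ num in codimension `p` with `p ≤ 2 ∨ n ≤ p + 1`, resp. both sides).
§2 **`numerical_of_extreme`** ((Num_t)(p,q) for `q ≤ 1 ∨ d ≤ q + 1`), **`nondegenerate_fiberOver_of_extreme`**,
**`comap_le_sup_of_extreme`** ((L)_t(p) for `p ≤ 1 ∨ d ≤ p + 1`), **`comap_le_sup_of_relDim_le_three`**,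
**`algebraicFixedPart_body_of_relDim_le_three`** (the body of (L∀) for every compact pencil of relative dimension `≤ 3`),
`invariantCyclesHoldFor_of_relDim_le_three`; `comap_le_sup_of_relDim_four` (for abelian-fourfold pencils the lift in every
degree follows from the single bidegree (Num_t)(2,2)), `numerical_two_two_of_surjOn_two` /
`comap_le_sup_of_relDim_four_of_surjOn_two` / `invariantCyclesHoldFor_of_relDim_four_of_surjOn_two` (… which follows from
ONE surjectivity `L : N²(𝒳) → N³(𝒳)` on the fivefold, the first open rung of seat ab-andre-1's `A`-ladder).

References: Lieberman1968 (Thm. 1: hom ≡ num in codimension 2 and dimension 1); Kleiman1968AlgebraicCycles (§3);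
VoisinHodgeI2002 (Thm. 11.30, §6.3.2, §7.1.2); VoisinHodgeII2003 (§10.2.3); Andre1996Motifs (§5.1); Milne2020HodgeClassesAV (Prop. 1).
-/

noncomputable section

set_option linter.dupNamespace false

namespace Summit.HodgeConjecture.HodgeConjecture.Ring2.AbelianAll

open CategoryTheory AlgebraicGeometry
open Literature.AlgebraicGeometry Literature.AlgebraicGeometry.Motives
open Literature.AlgebraicGeometry.HodgeTheory
open Literature.AlgebraicTopology.SingularHomology (singularCohomology cupProduct cupProduct_gradedComm_holds)
open Literature.Geometry.Kaehler (lefschetzPow HasHardLefschetzProperty)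
open Literature.AlgebraicGeometry.Abdulali1994 (InvariantCyclesHoldFor)
open Summit.HodgeConjecture.HodgeConjecture.Theses

/-! ## §1 Hom ≡ num in codimension `≤ 2` and `≥ n - 1` (Matsusaka, Lieberman), on the carriers -/

section Extreme

variable {n : ℕ} {X : SchemeOver ℂ}

/-- **The surjectivity clause of `A(X, η)` holds unconditionally in codimensions `p' ≤ 1`** for every polarisation class:
`L^{n-2p'} : N^{p'} → N^{n-p'}` is onto (`p' = 0`: `N⁰ = H⁰`; `p' = 1`: hard Lefschetz over `ℚ` and Lefschetz `(1,1)`, the tree's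
`lefschetzPow_surjOn_algebraicClasses_of_hodgeClasses_algebraic`). [cite: VoisinHodgeI2002, Thm. 11.30, Thm. 6.25 and §7.1.2]
[cite: Grothendieck1968, §3 p. 196 (A(X))] -/
theorem surjOn_lefschetzPow_algebraicClasses_of_le_one (hX : IsSmoothProjective n X) {η : complexBetti X 2}
    (hη : IsPolarizationClass n X η) {p' r' q' : ℕ} (hp' : p' ≤ 1) (hpr : 2 * p' + r' = n) (hq : p' + r' = q') :
    Set.SurjOn (lefschetzPow η r' (2 * p')) (algebraicClasses X p' : Set (complexBetti X (2 * p')))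
      (supportedClasses X (2 * p' + 2 * r') q') := by
  refine lefschetzPow_surjOn_algebraicClasses_of_hodgeClasses_algebraic hX hη hpr hq fun c hc hpp ↦ ?_
  interval_cases p'
  · simp [algebraicClasses_zero]
  · exact lefschetzOneOne_rational_holds hX c hc hpp

/-- **HOM ≡ NUM IN CODIMENSION `p ≤ 2` OR `p ≥ n - 1`, LEFT (Matsusaka; Lieberman 1968), on the carriers**: for `X` smooth
projective of dimension `n`, `p + q = n` with `p ≤ 2` or `n ≤ p + 1`, an algebraic class `ξ ∈ N^p(X)` cup-orthogonal to `N^q(X)`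
is zero. (Part XVIII-d's graded theorem: only the codimensions `p' < p`, `p' + p ≤ n`, i.e. `p' ≤ 1`, of `A` are needed.)
[cite: Lieberman1968, Thm. 1] [cite: Kleiman1968AlgebraicCycles, §3 Cor. 3.9] -/
theorem eq_zero_of_forall_cupProduct_algebraic_eq_zero_of_extreme (hX : IsSmoothProjective n X) {p q : ℕ}
    (hpq : p + q = n) (hp : p ≤ 2 ∨ n ≤ p + 1) {ξ : complexBetti X (2 * p)} (hξ : ξ ∈ algebraicClasses X p)
    (h : ∀ b ∈ algebraicClasses X q, cupProduct (show 2 * p + 2 * q = 2 * n by omega) ξ b = 0) : ξ = 0 := by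
  obtain ⟨D⟩ := nonempty_kaehlerRationalDatum hX
  exact eq_zero_of_forall_cupProduct_algebraic_eq_zero_of_surjOn_lt hX D hpq
    (fun p' r' q' h1 h2 h3 h4 ↦ surjOn_lefschetzPow_algebraicClasses_of_le_one hX (isPolarizationClass_Hη hX D)
      (by omega) h3 h4) hξ h

/-- **… RIGHT: for `q ≤ 2` or `n ≤ q + 1`, `b ∈ N^q(X)` cup-orthogonal to `N^p(X)` is zero.** [cite: Lieberman1968, Thm. 1] -/
theorem eq_zero_of_forall_cupProduct_algebraic_eq_zero_of_extreme' (hX : IsSmoothProjective n X) {p q : ℕ}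
    (hpq : p + q = n) (hq : q ≤ 2 ∨ n ≤ q + 1) {b : complexBetti X (2 * q)} (hb : b ∈ algebraicClasses X q)
    (h0 : ∀ ξ ∈ algebraicClasses X p, cupProduct (show 2 * p + 2 * q = 2 * n by omega) ξ b = 0) : b = 0 := by
  refine eq_zero_of_forall_cupProduct_algebraic_eq_zero_of_extreme hX (show q + p = n by omega) hq hb fun ξ hξ ↦ ?_
  rw [cupProduct_gradedComm_holds ℂ (ComplexPoints X) (show 2 * q + 2 * p = 2 * n by omega)
    (show 2 * p + 2 * q = 2 * n by omega) b ξ, h0 ξ hξ, smul_zero]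

/-- **(Perf) unconditionally in the extreme bidegrees**: the cup pairing `N^p(X) × N^q(X) → H^{2n}` is non-degenerate on both
sides whenever `p ≤ 2 ∨ n ≤ p + 1` and `q ≤ 2 ∨ n ≤ q + 1` — every bidegree for `n ≤ 4` (including the middle `(2,2)` of a
fourfold); the first bidegree not covered is `(2,3)` on a fivefold.
[cite: Lieberman1968, Thm. 1] [cite: Kleiman1968AlgebraicCycles, §3] -/
theorem nondegenerate_algebraicClasses_of_extreme (hX : IsSmoothProjective n X) {p q : ℕ} (hpq : p + q = n)
    (hp : p ≤ 2 ∨ n ≤ p + 1) (hq : q ≤ 2 ∨ n ≤ q + 1) :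
    (∀ ξ ∈ algebraicClasses X p,
        (∀ b ∈ algebraicClasses X q, cupProduct (show 2 * p + 2 * q = 2 * n by omega) ξ b = 0) → ξ = 0) ∧
      (∀ b ∈ algebraicClasses X q,
        (∀ ξ ∈ algebraicClasses X p, cupProduct (show 2 * p + 2 * q = 2 * n by omega) ξ b = 0) → b = 0) :=
  ⟨fun _ hξ h ↦ eq_zero_of_forall_cupProduct_algebraic_eq_zero_of_extreme hX hpq hp hξ h,
    fun _ hb h ↦ eq_zero_of_forall_cupProduct_algebraic_eq_zero_of_extreme' hX hpq hq hb h⟩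

end Extreme

/-! ## §2 Compact pencils: (Num_t), (Perf_t) and the lift in the extreme degrees; the lift for `d ≤ 3` -/

variable {𝒳 S : SchemeOver ℂ}

/-- **(Num_t)(p,q) IS UNCONDITIONAL for `q ≤ 1` or `q ≥ d - 1`**: the fibre-supported class `j_{t*} b ∈ N^{q+1}(𝒳)` has
codimension `≤ 2` or `≥ dim 𝒳 - 1`, where hom ≡ num holds (§1). [cite: Lieberman1968, Thm. 1] [cite: Kleiman1968AlgebraicCycles, §3] -/
theorem numerical_of_extreme {d : ℕ} {f : 𝒳 ⟶ S} (hf : IsCompactAbelianPencil f d) (t : ComplexPoints S) {p q : ℕ}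
    (hpq : p + q = d) (hq : q ≤ 1 ∨ d ≤ q + 1) :
    ∀ b ∈ algebraicClasses (fiberOver f t) q,
      (∀ a ∈ algebraicClasses 𝒳 p,
        cupProduct (show 2 * p + 2 * (q + 1) = 2 * (d + 1) by omega) a (fiberGysin hf t q b) = 0) →
        fiberGysin hf t q b = 0 :=
  fun b hb hab ↦ eq_zero_of_forall_cupProduct_algebraic_eq_zero_of_extreme' hf.isSmoothProjective_total
    (show p + (q + 1) = d + 1 by omega) (by omega) (fiberGysin_mem_algebraicClasses hf t hb) hab

/-- **(Perf_t)(p,q) IS UNCONDITIONAL when `p ≤ 2 ∨ d ≤ p + 1` and `q ≤ 2 ∨ d ≤ q + 1`** (§1 on the fibre).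
[cite: Lieberman1968, Thm. 1] -/
theorem nondegenerate_fiberOver_of_extreme {d : ℕ} {f : 𝒳 ⟶ S} (hf : IsCompactAbelianPencil f d)
    (t : ComplexPoints S) {p q : ℕ} (hpq : p + q = d) (hp : p ≤ 2 ∨ d ≤ p + 1) (hq : q ≤ 2 ∨ d ≤ q + 1) :
    (∀ ξ ∈ algebraicClasses (fiberOver f t) p,
        (∀ b ∈ algebraicClasses (fiberOver f t) q, cupProduct (show 2 * p + 2 * q = 2 * d by omega) ξ b = 0) → ξ = 0) ∧
      (∀ b ∈ algebraicClasses (fiberOver f t) q,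
        (∀ ξ ∈ algebraicClasses (fiberOver f t) p, cupProduct (show 2 * p + 2 * q = 2 * d by omega) ξ b = 0) → b = 0) :=
  nondegenerate_algebraicClasses_of_extreme (hf.isSmoothProjective_fiberOver t) hpq hp hq

/-- **THE LIFT (L)_t IN DEGREE `2p` IS UNCONDITIONAL FOR `p ≤ 1` OR `p ≥ d - 1`**, on every compact pencil of abelian varieties and
at every point `t`: `(j_t^*)⁻¹ N^p(𝒳_t) ≤ N^p(𝒳) ⊔ ker j_t^*` ((Perf_t) and (Num_t) unconditional, part XVIII-a's lift).
[cite: Lieberman1968, Thm. 1] [cite: Milne2020HodgeClassesAV, Prop. 1 (p. 7)] [cite: Andre1996Motifs, §5.1 (p. 25)] -/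
theorem comap_le_sup_of_extreme {d : ℕ} {f : 𝒳 ⟶ S} (hf : IsCompactAbelianPencil f d) (t : ComplexPoints S)
    {p q : ℕ} (hpq : p + q = d) (hp : p ≤ 1 ∨ d ≤ p + 1) :
    (algebraicClasses (fiberOver f t) p).comap (complexBetti.map (fiberι f t) (2 * p)).hom ≤
      algebraicClasses 𝒳 p ⊔ LinearMap.ker (complexBetti.map (fiberι f t) (2 * p)).hom := by
  obtain ⟨h₁, h₂⟩ := nondegenerate_fiberOver_of_extreme hf t hpq (by omega) (by omega)
  exact comap_le_sup_of_nondegenerate_of_numerical hf t hpq h₁ h₂ (numerical_of_extreme hf t hpq (by omega))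

/-- **THE LIFT (L)_t IN EVERY DEGREE FOR COMPACT PENCILS OF RELATIVE DIMENSION `d ≤ 3`** (every `p ≤ d` has `p ≤ 1` or
`p ≥ d - 1`; degrees `p > d` are vacuous). [cite: Lieberman1968, Thm. 1] [cite: Milne2020HodgeClassesAV, Prop. 1 (p. 7)] -/
theorem comap_le_sup_of_relDim_le_three {d : ℕ} (hd : d ≤ 3) {f : 𝒳 ⟶ S} (hf : IsCompactAbelianPencil f d)
    (t : ComplexPoints S) (p : ℕ) :
    (algebraicClasses (fiberOver f t) p).comap (complexBetti.map (fiberι f t) (2 * p)).hom ≤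
      algebraicClasses 𝒳 p ⊔ LinearMap.ker (complexBetti.map (fiberι f t) (2 * p)).hom := by
  rcases le_or_gt p d with hp | hp
  · exact comap_le_sup_of_extreme hf t (show p + (d - p) = d by omega) (by omega)
  · haveI := subsingleton_complexBetti (hf.isSmoothProjective_fiberOver t) (show 2 * d < 2 * p by omega)
    intro W _
    refine Submodule.mem_sup_right ?_
    rw [LinearMap.mem_ker]
    exact Subsingleton.elim _ _

/-- **THE ALGEBRAIC FIXED PART (L∀) FOR COMPACT PENCILS OF ABELIAN VARIETIES OF RELATIVE DIMENSION `≤ 3`, UNCONDITIONALLY**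
(the body of the node `AlgebraicFixedPart` restricted to `d ≤ 3`; part VI had `d ≤ 2` via the Hodge conjecture for
threefolds): a global class of the `(d+1)`-fold total space whose fibre restrictions are rational of type `(p,p)` agrees on
each fibre with a global ALGEBRAIC class — for `d = 3` this is new in the kernel (codimension `2` on FOURFOLDS fibred in abelian
threefolds: Lieberman's codimension-2 hom ≡ num on the total space + the Hodge conjecture for the threefold fibre + the lift
of part XVIII-a). First open relative dimension of the lift: `4` (the bidegree `(2,2)`: `D` in codimension `3` on fivefolds).
[cite: Lieberman1968, Thm. 1] [cite: VoisinHodgeII2003, §10.2.3 proof of Prop. 10.26] [cite: CharlesSchnell2014Notes, Proposition 11.3.5] -/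
theorem algebraicFixedPart_body_of_relDim_le_three {d : ℕ} (hd : d ≤ 3) {f : 𝒳 ⟶ S}
    (hf : IsCompactAbelianPencil f d) (p : ℕ) (W : complexBetti 𝒳 (2 * p))
    (hW : ∀ s : ComplexPoints S, IsRationalClass (complexBetti.map (fiberι f s) (2 * p) W) ∧
      IsOfHodgeType d (fiberOver f s) (2 * p) p p (complexBetti.map (fiberι f s) (2 * p) W))
    (s₀ : ComplexPoints S) :
    ∃ η ∈ algebraicClasses 𝒳 p,
      complexBetti.map (fiberι f s₀) (2 * p) η = complexBetti.map (fiberι f s₀) (2 * p) W := by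
  have halg : complexBetti.map (fiberι f s₀) (2 * p) W ∈ algebraicClasses (fiberOver f s₀) p :=
    hodgeClasses_algebraic_of_dim_le_three_holds hd (hf.isSmoothProjective_fiberOver s₀) p _ (hW s₀).1 (hW s₀).2
  obtain ⟨η, hη, κ, hκ, hW'⟩ := Submodule.mem_sup.1 (comap_le_sup_of_relDim_le_three hd hf s₀ p halg)
  refine ⟨η, hη, ?_⟩
  rw [LinearMap.mem_ker] at hκ
  rw [← hW', map_add]
  change _ = _ + (complexBetti.map (fiberι f s₀) (2 * p)).hom κ
  rw [hκ, add_zero]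

/-- **(1.1)_f for compact pencils of relative dimension `≤ 3`, unconditionally** (hom ≡ num route; classically also a
consequence of the Hodge conjecture for the threefold fibres). [cite: Abdulali1994FamiliesAV, (1.1) and p. 1122] -/
theorem invariantCyclesHoldFor_of_relDim_le_three {d : ℕ} (hd : d ≤ 3) {f : 𝒳 ⟶ S} (hf : IsCompactAbelianPencil f d) :
    InvariantCyclesHoldFor f d :=
  invariantCyclesHoldFor_of_nondegenerate_of_numerical hf fun t _ _ hpq ↦
    ⟨(nondegenerate_fiberOver_of_extreme hf t hpq (by omega) (by omega)).1,
      (nondegenerate_fiberOver_of_extreme hf t hpq (by omega) (by omega)).2,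
      numerical_of_extreme hf t hpq (by omega)⟩

/-- **The first open relative dimension, `d = 4`, reduced to ONE bidegree**: for a compact pencil of abelian FOURFOLDS (total
space a fivefold) the lift (L)_t holds in degrees `2p`, `p ≠ 2`, unconditionally, and in degree `4` it follows from
(Num_t)(2,2) alone — (Perf_t)(2,2) on the fourfold fibre being unconditional (§1, `p = q = 2`): "a codimension-2 algebraic class
`b` on the fibre with `a ∪ j_{t*}b = 0` for all `a ∈ N²(𝒳)` has `j_{t*}b = 0` (`j_{t*}b` of codimension 3 on the fivefold)".
[cite: Lieberman1968, Thm. 1] [cite: Kleiman1968AlgebraicCycles, §3 (D(X))] -/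
theorem comap_le_sup_of_relDim_four {f : 𝒳 ⟶ S} (hf : IsCompactAbelianPencil f 4) (t : ComplexPoints S) (p : ℕ)
    (hNum : ∀ b ∈ algebraicClasses (fiberOver f t) 2,
      (∀ a ∈ algebraicClasses 𝒳 2,
        cupProduct (show 2 * 2 + 2 * (2 + 1) = 2 * (4 + 1) by omega) a (fiberGysin hf t 2 b) = 0) →
        fiberGysin hf t 2 b = 0) :
    (algebraicClasses (fiberOver f t) p).comap (complexBetti.map (fiberι f t) (2 * p)).hom ≤
      algebraicClasses 𝒳 p ⊔ LinearMap.ker (complexBetti.map (fiberι f t) (2 * p)).hom := by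
  by_cases hp2 : p = 2
  · subst hp2
    obtain ⟨h₁, h₂⟩ := nondegenerate_fiberOver_of_extreme hf t (show 2 + 2 = 4 by rfl) (by omega) (by omega)
    exact comap_le_sup_of_nondegenerate_of_numerical hf t (show 2 + 2 = 4 by rfl) h₁ h₂ hNum
  rcases le_or_gt p 4 with hp | hp
  · exact comap_le_sup_of_extreme hf t (show p + (4 - p) = 4 by omega) (by omega)
  · haveI := subsingleton_complexBetti (hf.isSmoothProjective_fiberOver t) (show 2 * 4 < 2 * p by omega)
    intro W _
    refine Submodule.mem_sup_right ?_
    rw [LinearMap.mem_ker]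
    exact Subsingleton.elim _ _

/-- **`d = 4`: the single open bidegree (Num_t)(2,2) follows from ONE surjectivity on the fivefold total space**,
`L : N²(𝒳) → N³(𝒳)` onto for every polarisation class (the first open rung of seat ab-andre-1's `A`-ladder,
`standardACompactPencilsAtRelDim_four_iff_surjOn`): then part XVIII-d's graded hom ≡ num holds in codimension 3 on `𝒳`
(the codimensions `p' ≤ 2` of `A` being available), and kills the fibre-supported classes `j_{t*}N²(𝒳_t)`.
[cite: Kleiman1968AlgebraicCycles, §3 Cor. 3.9] [cite: Grothendieck1968, §3 p. 196 (A(X))] -/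
theorem numerical_two_two_of_surjOn_two {f : 𝒳 ⟶ S} (hf : IsCompactAbelianPencil f 4) (t : ComplexPoints S)
    (hA2 : ∀ η : complexBetti 𝒳 2, IsPolarizationClass (4 + 1) 𝒳 η →
      Set.SurjOn (lefschetzPow η 1 (2 * 2)) (algebraicClasses 𝒳 2 : Set (complexBetti 𝒳 (2 * 2)))
        (supportedClasses 𝒳 (2 * 2 + 2 * 1) 3)) :
    ∀ b ∈ algebraicClasses (fiberOver f t) 2,
      (∀ a ∈ algebraicClasses 𝒳 2,
        cupProduct (show 2 * 2 + 2 * (2 + 1) = 2 * (4 + 1) by omega) a (fiberGysin hf t 2 b) = 0) →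
        fiberGysin hf t 2 b = 0 := by
  intro b hb hab
  have h𝒳 := hf.isSmoothProjective_total
  obtain ⟨D⟩ := nonempty_kaehlerRationalDatum h𝒳
  have hA : ∀ (p' r' q' : ℕ), p' < 2 + 1 → p' + (2 + 1) ≤ 4 + 1 → 2 * p' + r' = 4 + 1 → p' + r' = q' →
      Set.SurjOn (lefschetzPow D.Hη r' (2 * p')) (algebraicClasses 𝒳 p' : Set (complexBetti 𝒳 (2 * p')))
        (supportedClasses 𝒳 (2 * p' + 2 * r') q') := by
    intro p' r' q' h1 _ h3 h4
    rcases Nat.lt_or_ge p' 2 with hp' | hp'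
    · exact surjOn_lefschetzPow_algebraicClasses_of_le_one h𝒳 (isPolarizationClass_Hη h𝒳 D) (by omega) h3 h4
    · obtain rfl : p' = 2 := by omega
      obtain rfl : r' = 1 := by omega
      subst h4
      exact hA2 D.Hη (isPolarizationClass_Hη h𝒳 D)
  refine eq_zero_of_forall_cupProduct_algebraic_eq_zero_of_surjOn_lt h𝒳 D (show (2 + 1) + 2 = 4 + 1 by rfl) hA
    (fiberGysin_mem_algebraicClasses hf t hb) fun a ha ↦ ?_
  rw [cupProduct_gradedComm_holds ℂ (ComplexPoints 𝒳) (show 2 * (2 + 1) + 2 * 2 = 2 * (4 + 1) by rfl)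
    (show 2 * 2 + 2 * (2 + 1) = 2 * (4 + 1) by rfl) _ a, hab a ha, smul_zero]

/-- **`d = 4`: ONE surjectivity on the fivefold gives the lift in every degree** (for classes algebraic on the fibre; the
abelian-fourfold fibre's own Hodge classes — Weil classes — are not touched). [cite: Kleiman1968AlgebraicCycles, §3 Cor. 3.9]
[cite: Milne2020HodgeClassesAV, Prop. 1 (p. 7)] -/
theorem comap_le_sup_of_relDim_four_of_surjOn_two {f : 𝒳 ⟶ S} (hf : IsCompactAbelianPencil f 4) (t : ComplexPoints S)
    (hA2 : ∀ η : complexBetti 𝒳 2, IsPolarizationClass (4 + 1) 𝒳 η →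
      Set.SurjOn (lefschetzPow η 1 (2 * 2)) (algebraicClasses 𝒳 2 : Set (complexBetti 𝒳 (2 * 2)))
        (supportedClasses 𝒳 (2 * 2 + 2 * 1) 3)) (p : ℕ) :
    (algebraicClasses (fiberOver f t) p).comap (complexBetti.map (fiberι f t) (2 * p)).hom ≤
      algebraicClasses 𝒳 p ⊔ LinearMap.ker (complexBetti.map (fiberι f t) (2 * p)).hom :=
  comap_le_sup_of_relDim_four hf t p (numerical_two_two_of_surjOn_two hf t hA2)

/-- **`d = 4`: ONE surjectivity on every fivefold total space gives Abdulali's (1.1)_f for every compact pencil of abelian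
fourfolds** ((Perf_t) in all bidegrees is unconditional on fourfold fibres). [cite: Abdulali1994FamiliesAV, (1.1) and p. 1122]
[cite: Lieberman1968, Thm. 1] -/
theorem invariantCyclesHoldFor_of_relDim_four_of_surjOn_two {f : 𝒳 ⟶ S} (hf : IsCompactAbelianPencil f 4)
    (hA2 : ∀ η : complexBetti 𝒳 2, IsPolarizationClass (4 + 1) 𝒳 η →
      Set.SurjOn (lefschetzPow η 1 (2 * 2)) (algebraicClasses 𝒳 2 : Set (complexBetti 𝒳 (2 * 2)))
        (supportedClasses 𝒳 (2 * 2 + 2 * 1) 3)) :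
    InvariantCyclesHoldFor f 4 := by
  rw [invariantCyclesHoldFor_iff_comap_eq hf]
  intro p s s'
  rcases le_or_gt p 4 with hp | hp
  · rw [le_antisymm (comap_le_sup_of_relDim_four_of_surjOn_two hf s hA2 p) (algebraicClasses_sup_ker_le_comap hf p s),
      le_antisymm (comap_le_sup_of_relDim_four_of_surjOn_two hf s' hA2 p) (algebraicClasses_sup_ker_le_comap hf p s'),
      algebraicClasses_sup_ker_eq hf p s s']
  · haveI := subsingleton_complexBetti (hf.isSmoothProjective_fiberOver s) (show 2 * 4 < 2 * p by omega)
    haveI := subsingleton_complexBetti (hf.isSmoothProjective_fiberOver s') (show 2 * 4 < 2 * p by omega)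
    ext W
    simp only [Submodule.mem_comap]
    constructor <;> intro _ <;>
      · rw [Subsingleton.elim ((complexBetti.map (fiberι f _) (2 * p)).hom W) 0]; exact Submodule.zero_mem _

end Summit.HodgeConjecture.HodgeConjecture.Ring2.AbelianAll

end
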